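import Mathlib
import Summits.AtomisticToContinuum.FouriersLaw.Theses.StaticAbelianSqueeze

/-!
# Sketch — crux idea `zero-mean-dyadic-splice` for (R) = `StaticAbelianSqueeze.UniformAbelianRegularity`
(item stmt-AtomisticToContinuum-13416; crux-ideate round 1, ideator 2; rev 3)

Contents
* `openCorrelation`, `abelDeficit` — the crux's own objects `c_N(t)`, `S_N(ν) = ∫₀^∞ (1 - e^{-νt}) c_N(t) dt`, named;
  `uniformAbelianRegularity_iff` — the crux through them (`Iff.rfl`).
* Typed stubs of the line over tree objects only (`transitionKernel`, `gibbsMeasure`, `bondCurrent`):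
  `LinearHorizonSplice` (K3 + K2), `HoelderWindowDensity` (K4), `PostCrossingSaturation` (K1, ν-free Bonnet form),
  the analytic core `ZeroMeanWindowLemma` (P3, pure real analysis: a smooth linear-horizon Abel window
  `W(t) = χ(t/τ)(1 - e^{-νt})` VANISHES at `t = 0`, so `∫ W C` sees only the modulus `g(ω) - g(0)` of the window density
  and the far spectrum only at order `ν`), and `DirectCompositionShape` (K3 ∧ K4 ∧ K1 ∧ P3 ⟹ crux).
* PROVED lemma `regularity_of_halvingDefect` (P1, real analysis): the alternative DIFFERENCE-ONLY composition — halving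
  quasi-additivity of `S_N(ν)` with a sublinear absorbing potential + fixed-`N` Abel regularity ⟹ the crux's conclusion
  with ONE `N₀` for all `ν` (strong induction down the halving tree); `PowerPotentialAbsorbs` records its power instance.
-/

noncomputable section

open MeasureTheory Filter Set Topology

namespace Summit.AtomisticToContinuum.FouriersLaw.Cruxes.UniformAbelianRegularity.ZeroMeanDyadicSplice

open Literature.MathematicalPhysics.KineticTheory.HeatConduction

/-- `c_N(t)`: equilibrium total-current autocorrelation of the open `N`-chain (both baths at `T`), verbatim the
integrand of the crux. -/
def openCorrelation (ω₂ lam β γ T : ℝ) (N : ℕ) (t : ℝ) : ℝ :=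
  ∫ z, (∑ i : Fin N, (pinnedChain ω₂ lam β γ).bondCurrent N i z) *
      (∫ y, (∑ i : Fin N, (pinnedChain ω₂ lam β γ).bondCurrent N i y)
        ∂((pinnedChain ω₂ lam β γ).transitionKernel N T T t.toNNReal z))
    ∂((pinnedChain ω₂ lam β γ).gibbsMeasure N T)

/-- `S_N(ν) = ∫₀^∞ (1 - e^{-νt}) c_N(t) dt`: the Abel deficit of the crux. -/
def abelDeficit (ω₂ lam β γ T : ℝ) (N : ℕ) (ν : ℝ) : ℝ :=
  ∫ t in Ioi (0:ℝ), (1 - Real.exp (-(ν * t))) * openCorrelation ω₂ lam β γ T N t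

/-- The crux through the named objects. -/
theorem uniformAbelianRegularity_iff :
    Summit.AtomisticToContinuum.FouriersLaw.Theses.StaticAbelianSqueeze.UniformAbelianRegularity ↔
      ∀ ω₂ lam β γ : ℝ, 0 < ω₂ → 0 < lam → 0 < β → 0 < γ → ∀ T : ℝ, 0 < T → ∀ ε : ℝ, 0 < ε →
        ∃ ν₀ : ℝ, 0 < ν₀ ∧ ∀ ν : ℝ, 0 < ν → ν < ν₀ → ∃ N₀ : ℕ, ∀ N : ℕ, N₀ ≤ N →
          |abelDeficit ω₂ lam β γ T N ν| ≤ ε * N :=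
  Iff.rfl

/-! ## First lemma: halving quasi-additivity with a sublinear potential ⟹ the crux's shape -/

/-- **FIRST LEMMA (P1).** Abstract real analysis: a family `S N ν` whose HALVING DEFECT is bounded by `D N` uniformly in
`ν ∈ (0, ν₁]`, with a non-negative potential `Ψ` that is sublinear (`Ψ N / N → 0`) and absorbs the defect under halving
(`Ψ N + D N ≤ Ψ (N/2) + Ψ (N - N/2)`), and which is Abel-regular at each fixed `N` (`S N ν → 0` as `ν ↓ 0`), satisfies
`∀ ε > 0 ∃ ν₀ > 0 ∃ N₀ ∀ ν ∈ (0, ν₀) ∀ N ≥ N₀, |S N ν| ≤ ε N` — the conclusion of `UniformAbelianRegularity` with a SINGLE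
`N₀` for all `ν`. Proof: strong induction on `N` down the halving tree to the leaves `[N*, 2N*)`, with the invariant
`|S N ν| ≤ ε N - Ψ N`. -/
theorem regularity_of_halvingDefect (S : ℕ → ℝ → ℝ) (D Ψ : ℕ → ℝ) (ν₁ : ℝ) (N₁ : ℕ)
    (hν₁ : 0 < ν₁)
    (hΨ : ∀ N, 0 ≤ Ψ N)
    (hstep : ∀ N : ℕ, 2 * N₁ ≤ N → Ψ N + D N ≤ Ψ (N / 2) + Ψ (N - N / 2))
    (hΨo : Tendsto (fun N : ℕ => Ψ N / (N : ℝ)) atTop (𝓝 0))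
    (hQA : ∀ N : ℕ, 2 * N₁ ≤ N → ∀ ν ∈ Set.Ioc (0:ℝ) ν₁,
      |S N ν - S (N / 2) ν - S (N - N / 2) ν| ≤ D N)
    (hfix : ∀ N : ℕ, Tendsto (S N) (𝓝[>] 0) (𝓝 0)) :
    ∀ ε : ℝ, 0 < ε → ∃ ν₀ : ℝ, 0 < ν₀ ∧ ∃ N₀ : ℕ, ∀ ν ∈ Set.Ioo (0:ℝ) ν₀, ∀ N : ℕ, N₀ ≤ N →
      |S N ν| ≤ ε * N := by
  intro ε hε
  have hε2 : (0:ℝ) < ε / 2 := by linarith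
  -- sublinearity of the potential: Ψ N ≤ (ε/2) N beyond Na
  obtain ⟨Na, hNa⟩ := eventually_atTop.1 (hΨo.eventually (Iic_mem_nhds hε2))
  set Ns : ℕ := max Na (max N₁ 1) with hNs_def
  have hNs_Na : Na ≤ Ns := le_max_left _ _
  have hNs_N₁ : N₁ ≤ Ns := (le_max_left _ _).trans (le_max_right _ _)
  have hNs_1 : 1 ≤ Ns := (le_max_right _ _).trans (le_max_right _ _)
  have hΨle : ∀ N : ℕ, Ns ≤ N → Ψ N ≤ ε / 2 * N := by
    intro N hN
    have hNpos : (0:ℝ) < N := by exact_mod_cast (hNs_1.trans hN)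
    have h' : Ψ N / (N:ℝ) ≤ ε / 2 := hNa N (hNs_Na.trans hN)
    rwa [div_le_iff₀ hNpos] at h'
  -- fixed-N Abel regularity on the finite set of leaves [Ns, 2Ns)
  have hleaf : ∀ᶠ ν in 𝓝[>] (0:ℝ), ∀ N ∈ Finset.Ico Ns (2 * Ns), |S N ν| < ε / 2 * N := by
    rw [Filter.eventually_all_finset]
    intro N hN
    have hNpos : (0:ℝ) < N := by
      have : Ns ≤ N := (Finset.mem_Ico.1 hN).1
      exact_mod_cast (hNs_1.trans this)
    have hr : (0:ℝ) < ε / 2 * N := mul_pos hε2 hNpos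
    have := (hfix N).eventually (Metric.ball_mem_nhds (0:ℝ) hr)
    refine this.mono ?_
    intro ν hν
    simpa [Real.dist_eq] using hν
  obtain ⟨u, hu, hsub⟩ := mem_nhdsGT_iff_exists_Ioo_subset.1 hleaf
  refine ⟨min u ν₁, lt_min hu hν₁, Ns, ?_⟩
  intro ν hν
  have hν0 : 0 < ν := hν.1
  have hνu : ν < u := hν.2.trans_le (min_le_left _ _)
  have hν₁' : ν ≤ ν₁ := (hν.2.trans_le (min_le_right _ _)).le
  have hleaf' : ∀ N ∈ Finset.Ico Ns (2 * Ns), |S N ν| < ε / 2 * N := hsub ⟨hν0, hνu⟩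
  -- the invariant down the halving tree
  have key : ∀ N : ℕ, Ns ≤ N → |S N ν| ≤ ε * N - Ψ N := by
    intro N
    induction N using Nat.strong_induction_on with
    | _ N ih =>
      intro hN
      by_cases hsmall : N < 2 * Ns
      · -- leaf
        have h1 : |S N ν| < ε / 2 * N := hleaf' N (Finset.mem_Ico.2 ⟨hN, hsmall⟩)
        have h2 : Ψ N ≤ ε / 2 * N := hΨle N hN
        linarith
      · -- split N = N/2 + (N - N/2)
        push Not at hsmall
        have hN2 : 2 ≤ N := by omega
        have hm : Ns ≤ N / 2 := by omega
        have hm' : Ns ≤ N - N / 2 := by omega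
        have hmlt : N / 2 < N := by omega
        have hm'lt : N - N / 2 < N := by omega
        have ihm := ih (N / 2) hmlt hm
        have ihm' := ih (N - N / 2) hm'lt hm'
        have hq := hQA N (by omega) ν ⟨hν0, hν₁'⟩
        have hs := hstep N (by omega)
        have hcast : ((N / 2 : ℕ) : ℝ) + ((N - N / 2 : ℕ) : ℝ) = (N : ℝ) := by
          have : N / 2 ≤ N := Nat.div_le_self _ _
          rw [Nat.cast_sub this]
          ring
        have htri : |S N ν| ≤ |S N ν - S (N / 2) ν - S (N - N / 2) ν| + |S (N / 2) ν| + |S (N - N / 2) ν| := by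
          have h3 := abs_add_three (S N ν - S (N / 2) ν - S (N - N / 2) ν) (S (N / 2) ν) (S (N - N / 2) ν)
          have heq : S N ν - S (N / 2) ν - S (N - N / 2) ν + S (N / 2) ν + S (N - N / 2) ν = S N ν := by ring
          rwa [heq] at h3
        calc |S N ν| ≤ D N + (ε * (N / 2 : ℕ) - Ψ (N / 2)) + (ε * (N - N / 2 : ℕ) - Ψ (N - N / 2)) := by
                linarith
          _ = ε * (((N / 2 : ℕ) : ℝ) + ((N - N / 2 : ℕ) : ℝ)) - (Ψ (N / 2) + Ψ (N - N / 2) - D N) := by ring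
          _ ≤ ε * N - Ψ N := by rw [hcast]; linarith
  intro N hN
  have := key N hN
  linarith [hΨ N]

/-- The power-law instance of the potential condition: `D N = C N^{1-δ}` is absorbed by `Ψ N = K N^{1-δ}` once
`K (2^δ - 1) > C` and `N` is large (so that the floor/ceiling halves are close enough to `N/2`). Elementary; left to the
line (not needed for the first lemma, which is abstract in `D, Ψ`). -/
def PowerPotentialAbsorbs : Prop :=
  ∀ C δ : ℝ, 0 ≤ C → 0 < δ → δ < 1 → ∃ K : ℝ, ∃ N₁ : ℕ, 0 ≤ K ∧ 1 ≤ N₁ ∧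
    ∀ N : ℕ, 2 * N₁ ≤ N →
      K * (N : ℝ) ^ (1 - δ) + C * (N : ℝ) ^ (1 - δ) ≤
        K * ((N / 2 : ℕ) : ℝ) ^ (1 - δ) + K * ((N - N / 2 : ℕ) : ℝ) ^ (1 - δ)

/-! ## Typed stubs of the line (all over finite-chain objects; the bulk function `C` and the end correction `E`
are existentially quantified functions pinned by the splice inequality — no infinite-volume dynamics is named) -/

/-- **K3 + K2 · LINEAR-HORIZON SPLICE WITH AN N-FREE END CORRECTION.** There are functions `C, E : ℝ → ℝ` (the
bulk summed current autocorrelation and the END CORRECTION `E = 2B - W`, contact excess minus bulk first spatial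
moment), constants and a cone slope `c₀ > 0` such that for `t ≤ c₀ N` the open-chain autocorrelation splits as
`c_N(t) = (N-1)·C(t) + E(t) + O(e^{-c(N - t/c₀)})`, and `E` has Cesàro-small mass `∫₀^τ |E| ≤ K τ^{1-δ}` (K2).
The first half is light-cone locality of the OPEN chain at linear horizons (extends the landed fixed-time matching
`c_N(t)/N → C_T(t)` and the N-uniform open-chain cone `stub_uniformAnchoredCorrelationTails`); the second is the
one-contact transport statement (fails at the harmonic corner: reflected phonons never decorrelate). -/
def LinearHorizonSplice : Prop :=
  ∀ ω₂ lam β γ : ℝ, 0 < ω₂ → 0 < lam → 0 < β → 0 < γ → ∀ T : ℝ, 0 < T →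
    ∃ (C E : ℝ → ℝ) (K c c₀ δ : ℝ) (N₁ : ℕ), 0 < c ∧ 0 < c₀ ∧ 0 < δ ∧ Measurable C ∧ Measurable E ∧
      (∀ N : ℕ, N₁ ≤ N → ∀ t : ℝ, 0 < t → t ≤ c₀ * N →
        |openCorrelation ω₂ lam β γ T N t - ((N:ℝ) - 1) * C t - E t| ≤ K * Real.exp (-(c * ((N:ℝ) - t / c₀)))) ∧
      (∀ τ : ℝ, 1 ≤ τ → ∫ t in Ioc (0:ℝ) τ, |E t| ≤ K * τ ^ (1 - δ)) ∧
      (∀ t : ℝ, 0 < t → |C t| ≤ K)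

/-- **K4 · HÖLDER WINDOW DENSITY OF THE BULK CURRENT SPECTRAL MEASURE** (the Mourre engine's output class + a modulus):
the bulk function `C` of the splice is the cosine transform of a finite measure `σ` on `ℝ` which, on a window `(-δ₀, δ₀)`,
is absolutely continuous with a density `g` that is HÖLDER continuous AT `0`: `|g ω - g 0| ≤ H |ω|^α`. No decay, no `L¹`,
no control of `σ` away from `0` is asked (atoms of `σ` off `0` — undamped current oscillations — are allowed). This is
`EmbeddedDrudeMourre.DrudeDissolution` / `LatticeLandauDamping.WindowDecomposition` for the regular pair, read through the
landed fixed-time matching `C = C_T`, plus the Hölder modulus that a `C^{1,1}` Mourre estimate delivers. -/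
def HoelderWindowDensity : Prop :=
  ∀ ω₂ lam β γ : ℝ, 0 < ω₂ → 0 < lam → 0 < β → 0 < γ → ∀ T : ℝ, 0 < T →
    ∀ (C E : ℝ → ℝ) (K c c₀ δ : ℝ) (N₁ : ℕ), 0 < c → 0 < c₀ →
      (∀ N : ℕ, N₁ ≤ N → ∀ t : ℝ, 0 < t → t ≤ c₀ * N →
        |openCorrelation ω₂ lam β γ T N t - ((N:ℝ) - 1) * C t - E t| ≤ K * Real.exp (-(c * ((N:ℝ) - t / c₀)))) →
      ∃ (σ : Measure ℝ) (δ₀ H α : ℝ) (g : ℝ → ℝ), IsFiniteMeasure σ ∧ 0 < δ₀ ∧ 0 < α ∧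
        (∀ t : ℝ, 0 < t → C t = ∫ ω, Real.cos (ω * t) ∂σ) ∧
        σ.restrict (Ioo (-δ₀) δ₀) = (volume.restrict (Ioo (-δ₀) δ₀)).withDensity (fun ω => ENNReal.ofReal (g ω)) ∧
        (∀ ω ∈ Ioo (-δ₀) δ₀, 0 ≤ g ω ∧ |g ω - g 0| ≤ H * |ω| ^ α)

/-- **K1 · POST-CROSSING SATURATION OF THE RUNNING GREEN–KUBO INTEGRAL** (the residual; ν-FREE, signed, power slack):
after the crossing time `c₀ N` the running Green–Kubo integral `∫₀^ξ c_N` makes no excursion larger than `K N^{1-δ}`: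
`sup_{ξ ≥ c₀ N} |∫_ξ^∞ c_N(t) dt| ≤ K N^{1-δ}`. By Bonnet's second mean-value theorem (monotone Abel weight) it implies the
ν-uniform late-window bound the composition consumes; it is where `lam, β > 0` must act (ballistic corner: `∼ N²`). A statement
about the SIGNED matrix element `c_N = ‖(P_{t/2}J)_odd‖² - ‖(P_{t/2}J)_even‖²`, not about norms — the landed negative lemma
`not_OddCorrectorDecay` (odd persistence) refutes the norm version and does not touch this. -/
def PostCrossingSaturation : Prop :=
  ∀ ω₂ lam β γ : ℝ, 0 < ω₂ → 0 < lam → 0 < β → 0 < γ → ∀ T : ℝ, 0 < T → ∀ c₀ : ℝ, 0 < c₀ →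
    ∃ (K δ : ℝ) (N₁ : ℕ), 0 < δ ∧ ∀ N : ℕ, N₁ ≤ N → ∀ ξ : ℝ, c₀ * N ≤ ξ →
      IntegrableOn (openCorrelation ω₂ lam β γ T N) (Ioi 0) ∧
      |∫ t in Ioi ξ, openCorrelation ω₂ lam β γ T N t| ≤ K * (N:ℝ) ^ (1 - δ)

/-- **P3 · ZERO-MEAN WINDOW LEMMA** (pure real analysis; the analytic core of the direct composition). Let `σ` be a
finite measure on `ℝ` with `C(t) = ∫ cos(ωt) dσ(ω)`, absolutely continuous on a window `(-δ₀, δ₀)` with density `g`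
obeying the modulus bound `|g ω - g 0| ≤ H |ω|^α` there. Let `χ` be a smooth cut-off, `χ = 1` on `[0, 1/2]`, `χ = 0` on
`[1, ∞)`, and `W(t) = χ(t/τ) (1 - e^{-νt})` the smooth linear-horizon Abel window — `W(0) = 0`, so the cosine transform
of `W` has ZERO MEAN and pairs with `g - g(0)` only. Then, uniformly in `ν ∈ (0, 1]` and `τ ≥ 1`:
`|∫₀^∞ W(t) C(t) dt| ≤ K · (ν^α + τ^{-α} + ν)` with `K` depending on `H, α, δ₀, σ(ℝ), g 0, χ` only
(the `ν`-term carries the far spectrum `|ω| ≥ δ₀`, atoms included: `∫ χ(t/τ)(1 - e^{-νt}) cos(ω₀ t) dt = -ν/(ν² + ω₀²)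
+ O((ω₀τ)^{-k})`). Stated with `χ` a fixed polynomial smooth-step to stay inside elementary Mathlib calculus. -/
def ZeroMeanWindowLemma : Prop :=
  ∀ (σ : Measure ℝ) (g : ℝ → ℝ) (δ₀ H α : ℝ), IsFiniteMeasure σ → 0 < δ₀ → 0 ≤ H → 0 < α → α < 1 →
    σ.restrict (Ioo (-δ₀) δ₀) = (volume.restrict (Ioo (-δ₀) δ₀)).withDensity (fun ω => ENNReal.ofReal (g ω)) →
    (∀ ω ∈ Ioo (-δ₀) δ₀, 0 ≤ g ω ∧ |g ω - g 0| ≤ H * |ω| ^ α) →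
    ∃ K : ℝ, ∀ ν : ℝ, 0 < ν → ν ≤ 1 → ∀ τ : ℝ, 1 ≤ τ →
      let χ : ℝ → ℝ := fun s => if s ≤ 1/2 then 1 else if 1 ≤ s then 0 else
        (1 - (2*s - 1)) ^ 3 * (1 + 3 * (2*s - 1) + 6 * (2*s - 1) ^ 2)   -- C² smooth-step from 1 to 0 on [1/2, 1]
      |∫ t in Ioi (0:ℝ), (χ (t / τ) * (1 - Real.exp (-(ν * t)))) * ∫ ω, Real.cos (ω * t) ∂σ| ≤
        K * (ν ^ α + τ ^ (-α) + ν)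

/-- **DIRECT COMPOSITION (the line's spine; recorded, to be kernel-checked by crux-plan).** With the smooth window at the
linear horizon `τ = c₀ N`: `S_N(ν) = ∫ W_N c_N + Λ_N(ν)`; the splice (K3) turns `∫ W_N c_N` into `(N-1) ∫ W_N C + ∫ W_N E
+ O(e^{-cN/2})`; P3 with K4 bounds the first by `(N-1) K (ν^α + (c₀N)^{-α} + ν)`, K2 bounds the second by `3K (c₀N)^{1-δ}`,
and Bonnet's second mean-value theorem (the late weight `(1 - χ(t/c₀N))(1 - e^{-νt})` is non-decreasing into `[0,1]`)
bounds `|Λ_N(ν)| ≤ 2 sup_{ξ ≥ c₀N/2} |∫_ξ^∞ c_N|`, which K1 makes `≤ 2K N^{1-δ}`. Hence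
`|S_N(ν)| ≤ C₁ N (ν^α + ν) + C₂ N^{1-min(α,δ)}` — the crux with ONE `N₀` for all `ν < ν₀` and a rate in both variables;
(K) is not even needed. -/
def DirectCompositionShape : Prop :=
  LinearHorizonSplice → HoelderWindowDensity → PostCrossingSaturation → ZeroMeanWindowLemma →
    Summit.AtomisticToContinuum.FouriersLaw.Theses.StaticAbelianSqueeze.UniformAbelianRegularity

/-- **ALTERNATIVE (difference-only) COMPOSITION.** The same four stubs also bound the HALVING DEFECT of `abelDeficit`
by `D N = C' N^{1-min(α,δ)}` uniformly in `ν` (the extensive bulk term cancels identically in `c_N - c_{N/2} - c_{N-N/2}`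
before the horizon; the window mismatch is a smooth bump vanishing near `t = 0`), `PowerPotentialAbsorbs` gives `Ψ`,
(K) `kuboAbelIdentity_holds` gives the fixed-`N` Abel regularity, and the PROVED `regularity_of_halvingDefect` closes the crux
BY NAME through `uniformAbelianRegularity_iff`. Works under a mere DINI modulus of `g` at `0`. -/
def CompositionShape : Prop :=
  LinearHorizonSplice → HoelderWindowDensity → PostCrossingSaturation → PowerPotentialAbsorbs →
    Summit.AtomisticToContinuum.FouriersLaw.Theses.StaticAbelianSqueeze.UniformAbelianRegularity

end Summit.AtomisticToContinuum.FouriersLaw.Cruxes.UniformAbelianRegularity.ZeroMeanDyadicSplice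

end
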